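import Literature.MathematicalPhysics.QuantumFieldTheory.Balaban1983to89.B9Eq316TowerFlatIsOneStep
import Literature.MathematicalPhysics.QuantumFieldTheory.Balaban1983to89.B9Eq349BlockDecayFromKernel

/-!
# `Balaban1983to89.B9Eq342TowerBigBlocks` — T. Bałaban, *Propagators for lattice gauge theories in a background field*, Commun. Math. Phys. **99**
# (1985) 389–434 [Balaban1985BackgroundPropagators] (3.15) p. 393 (the `j`-fold averagings `Q_j(U)`) and (3.19) p. 393 (*«(Q′_j(U)λ)(y) = Σ_{x∈B^j(y)}
# L^{−jd}R(U(Γ^{(j)}_{y,x}))λ(x)»* — the big blocks `B^j(y)` of side `L^j` over the unit lattice), Thm 3.1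
# (3.42) p. 397 and (3.49) p. 399 (*«e^{−δ₀d(y,y′)} for x ∈ Δ(y), x′ ∈ Δ(y′)»* — decay measured between the UNIT blocks containing the fine sites),
# over the block geometry of [Balaban1985Averaging] (1)–(2) p. 17: **THE BIG BLOCKS OF THE TOWER — the top torus `T_{(L^k·m)}` of the tower read as the
# one-step fine torus over `T_m` with block size `L^k` (`towerP L m k = fineP (L^k) m`, `B9Eq316TowerFlatIsOneStep.towerP_eq_fineP_pow` + `siteCast`):
# the big-block map `Π = blockCoord (L^k) m ∘ siteCast`, its coordinates, the two-sided comparison `L^k·d_m(Πx, Πx′) − (L^k − 1) ≤ d_{(L^k m)}(x, x′) ≤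
# L^k·d_m(Πx, Πx′) + (L^k − 1)`, and the fibre count `#Π⁻¹(y) ≤ (L^k)^d`** — items (a)–(b) of the pub-balaban NE9 owner's «§3 PRECISION» for the TOWER
# twin of the (3.42) value row (`t4/b2b-balaban-t4-ne9-p1/g90/STOREY-D-ASSEMBLY.md` §3: «the BIG-block map `π x = (x_i ∕ L^{n+1})_i : TSite d (towerP L m
# (n+1)) → TSite d m` … `hWd` at block size `L^{n+1}`: `L^{n+1}·d_m(πx₀,πx) − (L^{n+1} − 1) ≤ d_{towerP}(x₀,x)` (leaf-01's `mul_tdist_blockCoord_sub_le_tdist`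
# read at block size `L^{n+1}` along `towerP_eq_fineP_pow` + `siteCast`, or re-proved directly for `π`)»)

statement-level skeleton of published theorems with citation tags; proofs where landed; nothing here is a claim about the Yang–Mills mass gap

CITATION HEADER (lean-in-tree rule).  Audit cell `pub-balaban`, sub-cell `t4`, BINDER row NE9; filed by NE9 crux-team LEAF PROVER 03
(`b2b-balaban-t4-ne9-formalise-leaf-03`, gen 71).  Composed BY NAME, along the cast: ne9-leaf-05's `B9Eq316TowerFlatIsOneStep` (`towerP_eq_fineP_pow`,
`siteCast`, `siteCast_apply_val`), ne9-leaf-01's `B9Eq349BlockDistanceWeight` (`mul_tdist_blockCoord_sub_le_tdist`, `tdist_le_mul_tdist_blockCoord_add`,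
`tdist_le_of_blockCoord_eq`), ne9-leaf-06's `B9Eq349BlockDecayFromKernel.card_sites_block_le`, the cell's `B4Sect5Torus.tdist`.  Sources READ (renders
`HOME/b2b-balaban-ref1/pages/1985-cmp99-background-propagators/…-p005∕p009∕p011`): [Balaban1985BackgroundPropagators] p. 393 (3.14)–(3.19) (quoted), p. 397
(3.42), p. 399 (3.49).  NOTHING printed is asserted: lattice geometry only.

WHAT IS PROVED (sorry-free; proof lane — no `def`: the big-block map is the displayed TERM `blockCoord (L^k) m (siteCast (towerP_eq_fineP_pow L m k) x)`,
never a definition; [folklore]).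
* §1 casts: **`tdist_siteCast`** (`siteCast` is an isometry of the torus distances along any period identity `P = P′`); **`siteCast_eq_iff`**.
* §2 the big blocks (`1 ≤ L`, any height `k`): **`bigBlock_apply_val`** (`(Πx)_i = x_i ∕ L^k`); **`mul_tdist_bigBlock_sub_le_tdist`**,
  **`tdist_le_mul_tdist_bigBlock_add`** (the two-sided comparison — the geometric half of the tower's `hWd`); **`tdist_le_of_bigBlock_eq`** (one big block
  has diameter `≤ L^k − 1`); **`card_sites_bigBlock_le`** (`#Π⁻¹(y) ≤ (L^k)^d` — the fibre count `N` of `B9Eq347GlobalFromLocal.rowSum_kernelOf_le_of_local`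
  ∕ `B9Eq347LocalLetterAlgebra.local_of_kernel` at the tower).
HONEST SCOPE.  Geometry of the index sets only — no operator, no weight, no estimate of print; the (K1) block family over `Π` is supplied for ANY map by
ne9-leaf-01's `B9Eq349BlockMultipliers.exists_block_clm_family`, the weights∕rates of the tower twin are the owner lineage's (`rate_explicit`).  NOT NE9
(cell pub-balaban: NE9 NOT PRINTED ∕ NOT PROVED; «NE9 ⇐ the named binders»; row WALLED ON A MODEL (O-NE9-1; #5 UNRULED); spine PROVED 0∕9; rung (B)+1 on a
finite T⁴ — NOT infinite volume, NOT mass gap, NOT Clay; HONEST DEPENDENCY: continuum YM on T⁴ ⇐ BetaPertH ∧ nine spine estimates (0/9 proved); BetaPertH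
⇐ (D1) ∧ (D4) ∧ CAP+tail; G-an2-4 gates asym, D1 and NE2/3/4).  NEW file importing `B9Eq316TowerFlatIsOneStep` + `B9Eq349BlockDecayFromKernel` (both
built); nothing modified.  Net new unproved facts: 0.
-/

noncomputable section

open scoped BigOperators

namespace Literature.MathematicalPhysics.QuantumFieldTheory.Balaban1983to89.B9Eq342TowerBigBlocks

open B4Sect5Torus (TSite tdist)
open B9Eq315QTower (towerP)
open B9Eq319QprimeTorus (fineP blockCoord blockCoord_apply_val)
open B9Eq316TowerFlatIsOneStep (towerP_eq_fineP_pow siteCast siteCast_apply_val)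
open B9Eq349BlockDistanceWeight (mul_tdist_blockCoord_sub_le_tdist tdist_le_mul_tdist_blockCoord_add tdist_le_of_blockCoord_eq)
open B9Eq349BlockDecayFromKernel (card_sites_block_le)

variable {d : ℕ}

/-! ## §1 The site cast along a period identity is an isometry -/

section Cast

variable {P P' : Fin d → ℕ}

/-- **`siteCast` PRESERVES THE TORUS DISTANCE**: `d_{P′}(cast x, cast y) = d_P(x, y)` along any period identity `P = P′` (the lattice (1) of [B7] under two
typings). [folklore] [cite: Balaban1985Averaging, (1)–(2) p.17; Balaban1985BackgroundPropagators, (3.15), (3.19) p.393] -/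
@[simp] theorem tdist_siteCast (h : P = P') (x y : TSite d P) : tdist P' (siteCast h x) (siteCast h y) = tdist P x y := by
  subst h; rfl

/-- `siteCast` is injective on equations: `cast x = cast y ↔ x = y`. [folklore] [cite: Balaban1985Averaging, (1)–(2) p.17] -/
theorem siteCast_eq_iff (h : P = P') (x y : TSite d P) : siteCast h x = siteCast h y ↔ x = y :=
  (siteCast h).injective.eq_iff

end Cast

/-! ## §2 The big blocks of side `L^k` of the tower's top torus over the unit torus `T_m` -/

section BigBlocks

variable (L : ℕ) [NeZero L] (m : Fin d → ℕ) (k : ℕ)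

omit [NeZero L] in
/-- **COORDINATES OF THE BIG-BLOCK MAP** `Π = blockCoord (L^k) m ∘ siteCast`: `(Πx)_i = x_i ∕ L^k` — print's «x ∈ Δ(y)» for the unit block `Δ(y)`
containing the fine site `x ∈ T_{(L^k m)}`. [cite: Balaban1985BackgroundPropagators, (3.15), (3.19) p.393, (3.49) p.399; Balaban1985Averaging, (2) p.17] -/
theorem bigBlock_apply_val (x : TSite d (towerP L m k)) (i : Fin d) :
    ((blockCoord (L ^ k) m (siteCast (towerP_eq_fineP_pow L m k) x) i : ℕ)) = (x i : ℕ) / L ^ k := by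
  rw [blockCoord_apply_val, siteCast_apply_val]

/-- **THE TOWER's `hWd`, GEOMETRIC HALF**: `L^k·d_m(Πx, Πx′) − (L^k − 1) ≤ d_{(L^k m)}(x, x′)` — the fine distance on the top torus dominates `L^k` times
the unit-block distance up to one big-block width (ne9-leaf-01's `mul_tdist_blockCoord_sub_le_tdist` at block size `L^k`, along the cast).
[folklore] [cite: Balaban1985BackgroundPropagators, (3.49) p.399, (3.15), (3.19) p.393; Balaban1985Averaging, (2) p.17] -/
theorem mul_tdist_bigBlock_sub_le_tdist (hm : ∀ i, 1 ≤ m i) (x x' : TSite d (towerP L m k)) :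
    ((L : ℝ) ^ k) * tdist m (blockCoord (L ^ k) m (siteCast (towerP_eq_fineP_pow L m k) x))
        (blockCoord (L ^ k) m (siteCast (towerP_eq_fineP_pow L m k) x')) - ((L : ℝ) ^ k - 1) ≤ tdist (towerP L m k) x x' := by
  have h := mul_tdist_blockCoord_sub_le_tdist (L := L ^ k) (m := m) hm (siteCast (towerP_eq_fineP_pow L m k) x)
    (siteCast (towerP_eq_fineP_pow L m k) x')
  rw [tdist_siteCast] at h
  exact_mod_cast h

/-- **… AND THE CONVERSE**: `d_{(L^k m)}(x, x′) ≤ L^k·d_m(Πx, Πx′) + (L^k − 1)`. [folklore]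
[cite: Balaban1985BackgroundPropagators, (3.49) p.399; Balaban1985Averaging, (2) p.17] -/
theorem tdist_le_mul_tdist_bigBlock_add (hm : ∀ i, 1 ≤ m i) (x x' : TSite d (towerP L m k)) :
    tdist (towerP L m k) x x' ≤ ((L : ℝ) ^ k) * tdist m (blockCoord (L ^ k) m (siteCast (towerP_eq_fineP_pow L m k) x))
        (blockCoord (L ^ k) m (siteCast (towerP_eq_fineP_pow L m k) x')) + ((L : ℝ) ^ k - 1) := by
  have h := tdist_le_mul_tdist_blockCoord_add (L := L ^ k) (m := m) hm (siteCast (towerP_eq_fineP_pow L m k) x)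
    (siteCast (towerP_eq_fineP_pow L m k) x')
  rw [tdist_siteCast] at h
  exact_mod_cast h

/-- **ONE BIG BLOCK HAS DIAMETER `≤ L^k − 1`**. [folklore] [cite: Balaban1985Averaging, (2) p.17; Balaban1985BackgroundPropagators, (3.49) p.399] -/
theorem tdist_le_of_bigBlock_eq (hm : ∀ i, 1 ≤ m i) {x x' : TSite d (towerP L m k)}
    (h : blockCoord (L ^ k) m (siteCast (towerP_eq_fineP_pow L m k) x) = blockCoord (L ^ k) m (siteCast (towerP_eq_fineP_pow L m k) x')) :
    tdist (towerP L m k) x x' ≤ (L : ℝ) ^ k - 1 := by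
  have h1 := tdist_le_of_blockCoord_eq (L := L ^ k) (m := m) hm h
  rw [tdist_siteCast] at h1
  exact_mod_cast h1

/-- **THE FIBRE COUNT OF THE BIG BLOCKS**: `#{x ∈ T_{(L^k m)} : Πx = y} ≤ (L^k)^d` (ne9-leaf-06's `card_sites_block_le` at block size `L^k`, transported along
the cast, which is a bijection) — the `N` of `B9Eq347GlobalFromLocal.rowSum_kernelOf_le_of_local` ∕ `B9Eq347LocalLetterAlgebra.local_of_kernel` at the tower.
[folklore] [cite: Balaban1985Averaging, (2) p.17; Balaban1985BackgroundPropagators, (3.15), (3.19) p.393] -/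
theorem card_sites_bigBlock_le (y : TSite d m) :
    (Finset.univ.filter (fun x : TSite d (towerP L m k) =>
        blockCoord (L ^ k) m (siteCast (towerP_eq_fineP_pow L m k) x) = y)).card ≤ (L ^ k) ^ d := by
  classical
  have hmap : (Finset.univ.filter (fun x : TSite d (towerP L m k) =>
      blockCoord (L ^ k) m (siteCast (towerP_eq_fineP_pow L m k) x) = y)).card =
      (Finset.univ.filter (fun x' : TSite d (fineP (L ^ k) m) => blockCoord (L ^ k) m x' = y)).card := by
    refine Finset.card_bij (fun x _ => siteCast (towerP_eq_fineP_pow L m k) x) (fun x hx => ?_) (fun x₁ _ x₂ _ h => ?_) (fun x' hx' => ?_)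
    · simpa using hx
    · exact (siteCast _).injective h
    · refine ⟨(siteCast (towerP_eq_fineP_pow L m k)).symm x', ?_, Equiv.apply_symm_apply _ _⟩
      simpa using hx'
  rw [hmap]
  exact card_sites_block_le (L := L ^ k) (m := m) y

end BigBlocks

end Literature.MathematicalPhysics.QuantumFieldTheory.Balaban1983to89.B9Eq342TowerBigBlocks

end
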